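import Summits.Parity.GeneralizedHardyLittlewood.Theorems.BeyondDiagonalBeatsQuarter.CornerAbel
import HarnessLib

/-!
# Route `PrimeLevelFamEdge`, crux K_A `MomentsBeyondDiagonal` (stmt-Parity-20007), line «petersson_layers» v4, stub `stub_diag`:
# **δ-subtraction for a MIXED both-sided remainder monomial `b₁ ⊗ b₂ · R`** (both factors with convergent partial sums;
# the two-sequence form of `…DiagRemDeltaSubPow.abs_doubleSum_delta_sub_le_pow`)

With «DRTAIL»_r (`…DiagRemMomentTailBoundPow`) every moment-decorated Selberg coefficient sequence `b = a_n·m_r` has convergent partial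
sums `Σ_{k ≤ y} b(k) = c + O(D(n)(1+log y)⁻ᴬ)`. The both-sided monomials `m_r ⊗ m_s · R` of the order-`(i,j)` remainder weights (for
`(i,j) = (4,4)`: `P₂⊗P₂`, `P₂⊗D₄`, `P₂⊗D₆`, `D₄⊗D₄`; at higher orders every pair) are then handled by ONE δ-subtraction lemma for two
possibly different sequences: writing `b₁ = c₁δ₁ + b̃₁`, `b₂ = c₂δ₁ + b̃₂`,
`b₁ ⊗ b₂ = b̃₁ ⊗ b₂ + c₁·(δ₁ ⊗ b̃₂) + c₁c₂·(δ₁ ⊗ δ₁)`, and the two-sequence Abel estimate `hR2` is applied to `(b̃₁, b₂)` and (after the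
swap `k₁ ↔ k₂`) to `(b̃₂, δ₁)`.

* `abs_doubleSum_delta_sub_two_le_pow` — **the bound for `Σ_{k₁,k₂≤Y} b₁(k₁)b₂(k₂)ℓ⁺ⁱℓ⁺ʲR(αk₁k₂)`, envelope exponent `N`**; with `b₁ = b₂`
  it is `abs_doubleSum_delta_sub_le_pow`.

Def-free; theorems only; elementary. Helper `--supports stmt-Parity-20007`; closes nothing; K_A, K_B and the Parity summit are NOT
proved; nothing about Landau–Siegel zeros.

## References
* E. Kowalski, P. Michel, J. VanderKam, J. reine angew. Math. 526 (2000), Prop. 5.1 p. 18.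
  [cite: KowalskiMichelVanderKam2000, Prop. 5.1 — derivation (both-sided decorated remainder monomials)]
-/

noncomputable section

open Real Finset

namespace Summit.Parity.GeneralizedHardyLittlewood.Theorems.MomentsBeyondDiagonal.DiagCorner

open Summit.Parity.GeneralizedHardyLittlewood.Theorems.BeyondDiagonalBeatsQuarter.Corner

set_option maxHeartbeats 800000 in
/-- **δ-subtraction for a mixed both-sided decorated remainder monomial `b₁ ⊗ b₂ · R`.** Let `R` satisfy the two-sequence estimate
`hR2` (constant `C₀`, envelope exponent `N`). Let `b₂` have column bound `B₂` (`|Σ_{k≤e}b₂| ≤ B₂`, `e ≤ ⌊Y⌋`), and let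
`b̃₁ = b₁ − c₁δ₁`, `b̃₂ = b₂ − c₂δ₁` have tails `|Σ_{k≤e} b̃ᵢ| ≤ Tᵢ` for `e ≥ K₁`. Then `|Σ_{k₁,k₂≤Y} b₁(k₁)b₂(k₂)ℓ⁺(k₁)ⁱℓ⁺(k₂)ʲR(αk₁k₂)|`
is at most `[S_i(b̃₁)·B₂·logʲY·3C₀√(2αK₁Y) + S_j(b₂)·2T₁·logⁱY·9C₀xᴺ] + |c₁|·[S_j(b̃₂)·logⁱY·3C₀√(2αK₁Y) + S_i(δ₁)·2T₂·logʲY·9C₀xᴺ]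
+ |c₁||c₂|·ℓ⁺(1)ⁱℓ⁺(1)ʲ·|R(α)|` (`x = 1+|log 2αY²|`, `S_m(f) = Σ_{k≤Y}|f(k)|ℓ⁺(k)^m`).
[cite: KowalskiMichelVanderKam2000, Prop. 5.1 — derivation (both-sided decorated remainder monomials)] -/
theorem abs_doubleSum_delta_sub_two_le_pow (N : ℕ) {R : ℝ → ℝ} {C₀ : ℝ}
    (hR2 : ∀ (a₁ a₂ : ℕ → ℝ) (Y α B η : ℝ) (K₁ i j : ℕ), 1 ≤ Y → 0 < α → 1 ≤ i → 1 ≤ j →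
      (∀ e : ℕ, e ≤ ⌊Y⌋₊ → |∑ k ∈ Icc 1 e, a₂ k| ≤ B) → (∀ e : ℕ, K₁ ≤ e → |∑ k ∈ Icc 1 e, a₁ k| ≤ η) →
      2 * α * K₁ * Y ≤ 1 →
      |∑ k₁ ∈ Icc 1 ⌊Y⌋₊, ∑ k₂ ∈ Icc 1 ⌊Y⌋₊,
          a₁ k₁ * a₂ k₂ * ellp Y k₁ ^ i * ellp Y k₂ ^ j * R (α * k₁ * k₂)| ≤
        (∑ k ∈ Icc 1 ⌊Y⌋₊, |a₁ k| * ellp Y k ^ i) * (B * (Real.log Y ^ j * (3 * C₀ * Real.sqrt (2 * α * K₁ * Y)))) +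
          (∑ k ∈ Icc 1 ⌊Y⌋₊, |a₂ k| * ellp Y k ^ j) *
            ((2 * η) * (Real.log Y ^ i * (9 * C₀ * (1 + |Real.log (2 * α * Y ^ 2)|) ^ N))))
    (b₁ b₂ : ℕ → ℝ) (c₁ c₂ T₁ T₂ B₂ : ℝ) {Y α : ℝ} {K₁ i j : ℕ} (hY : 1 ≤ Y) (hα : 0 < α) (hi : 1 ≤ i) (hj : 1 ≤ j)
    (hY₁ : 2 * α * K₁ * Y ≤ 1)
    (hbt₁ : ∀ e : ℕ, K₁ ≤ e → |∑ k ∈ Icc 1 e, (b₁ k - if k = 1 then c₁ else 0)| ≤ T₁)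
    (hbt₂ : ∀ e : ℕ, K₁ ≤ e → |∑ k ∈ Icc 1 e, (b₂ k - if k = 1 then c₂ else 0)| ≤ T₂)
    (hbcol₂ : ∀ e : ℕ, e ≤ ⌊Y⌋₊ → |∑ k ∈ Icc 1 e, b₂ k| ≤ B₂) :
    |∑ k₁ ∈ Icc 1 ⌊Y⌋₊, ∑ k₂ ∈ Icc 1 ⌊Y⌋₊, b₁ k₁ * b₂ k₂ * ellp Y k₁ ^ i * ellp Y k₂ ^ j * R (α * k₁ * k₂)| ≤
      ((∑ k ∈ Icc 1 ⌊Y⌋₊, |b₁ k - if k = 1 then c₁ else 0| * ellp Y k ^ i) *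
          (B₂ * (Real.log Y ^ j * (3 * C₀ * Real.sqrt (2 * α * K₁ * Y)))) +
        (∑ k ∈ Icc 1 ⌊Y⌋₊, |b₂ k| * ellp Y k ^ j) *
          ((2 * T₁) * (Real.log Y ^ i * (9 * C₀ * (1 + |Real.log (2 * α * Y ^ 2)|) ^ N)))) +
      |c₁| * ((∑ k ∈ Icc 1 ⌊Y⌋₊, |b₂ k - if k = 1 then c₂ else 0| * ellp Y k ^ j) *
          (1 * (Real.log Y ^ i * (3 * C₀ * Real.sqrt (2 * α * K₁ * Y)))) +
        (∑ k ∈ Icc 1 ⌊Y⌋₊, |(if k = 1 then (1 : ℝ) else 0)| * ellp Y k ^ i) *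
          ((2 * T₂) * (Real.log Y ^ j * (9 * C₀ * (1 + |Real.log (2 * α * Y ^ 2)|) ^ N)))) +
      |c₁| * |c₂| * ellp Y 1 ^ i * ellp Y 1 ^ j * |R α| := by
  set I := Icc 1 ⌊Y⌋₊ with hI
  set bt₁ : ℕ → ℝ := fun k ↦ b₁ k - if k = 1 then c₁ else 0 with hbt₁def
  set bt₂ : ℕ → ℝ := fun k ↦ b₂ k - if k = 1 then c₂ else 0 with hbt₂def
  set δ : ℕ → ℝ := fun k ↦ if k = 1 then (1 : ℝ) else 0 with hδdef
  have hY0 : 0 < Y := by linarith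
  have h1I : 1 ∈ I := by
    rw [hI, Finset.mem_Icc]; exact ⟨le_rfl, Nat.le_floor (by simpa using hY)⟩
  have hb₁ : ∀ k, b₁ k = bt₁ k + c₁ * δ k := by
    intro k; simp only [hbt₁def, hδdef]; split_ifs <;> ring
  have hb₂ : ∀ k, b₂ k = bt₂ k + c₂ * δ k := by
    intro k; simp only [hbt₂def, hδdef]; split_ifs <;> ring
  -- `b₁⊗b₂ = b̃₁⊗b₂ + c₁·δ⊗b̃₂ + c₁c₂·δ⊗δ`
  have hsplit : ∑ k₁ ∈ I, ∑ k₂ ∈ I, b₁ k₁ * b₂ k₂ * ellp Y k₁ ^ i * ellp Y k₂ ^ j * R (α * k₁ * k₂) =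
      (∑ k₁ ∈ I, ∑ k₂ ∈ I, bt₁ k₁ * b₂ k₂ * ellp Y k₁ ^ i * ellp Y k₂ ^ j * R (α * k₁ * k₂)) +
      c₁ * (∑ k₁ ∈ I, ∑ k₂ ∈ I, δ k₁ * bt₂ k₂ * ellp Y k₁ ^ i * ellp Y k₂ ^ j * R (α * k₁ * k₂)) +
      c₁ * c₂ * (∑ k₁ ∈ I, ∑ k₂ ∈ I, δ k₁ * δ k₂ * ellp Y k₁ ^ i * ellp Y k₂ ^ j * R (α * k₁ * k₂)) := by
    rw [Finset.mul_sum, Finset.mul_sum, ← Finset.sum_add_distrib, ← Finset.sum_add_distrib]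
    refine Finset.sum_congr rfl fun k₁ _ ↦ ?_
    rw [Finset.mul_sum, Finset.mul_sum, ← Finset.sum_add_distrib, ← Finset.sum_add_distrib]
    refine Finset.sum_congr rfl fun k₂ _ ↦ ?_
    have e2 : b₂ k₂ = bt₂ k₂ + c₂ * δ k₂ := hb₂ k₂
    rw [hb₁ k₁]
    have : (bt₁ k₁ + c₁ * δ k₁) * b₂ k₂ = bt₁ k₁ * b₂ k₂ + c₁ * δ k₁ * (bt₂ k₂ + c₂ * δ k₂) := by rw [← e2]; ring
    rw [this]; ring
  have hδδ : ∑ k₁ ∈ I, ∑ k₂ ∈ I, δ k₁ * δ k₂ * ellp Y k₁ ^ i * ellp Y k₂ ^ j * R (α * k₁ * k₂) =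
      ellp Y 1 ^ i * ellp Y 1 ^ j * R α := by
    rw [Finset.sum_eq_single_of_mem 1 h1I (fun k₁ _ hk₁ ↦ by
      simp only [hδdef, if_neg hk₁, zero_mul, Finset.sum_const_zero])]
    rw [Finset.sum_eq_single_of_mem 1 h1I (fun k₂ _ hk₂ ↦ by
      simp only [hδdef, if_neg hk₂, mul_zero, zero_mul])]
    simp only [hδdef, if_true, Nat.cast_one, mul_one, one_mul]
  have hswap : ∑ k₁ ∈ I, ∑ k₂ ∈ I, δ k₁ * bt₂ k₂ * ellp Y k₁ ^ i * ellp Y k₂ ^ j * R (α * k₁ * k₂) =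
      ∑ k₁ ∈ I, ∑ k₂ ∈ I, bt₂ k₁ * δ k₂ * ellp Y k₁ ^ j * ellp Y k₂ ^ i * R (α * k₁ * k₂) := by
    rw [Finset.sum_comm]
    refine Finset.sum_congr rfl fun k₁ _ ↦ Finset.sum_congr rfl fun k₂ _ ↦ ?_
    rw [show α * (k₂ : ℝ) * k₁ = α * k₁ * k₂ by ring]; ring
  have hδcol : ∀ e : ℕ, e ≤ ⌊Y⌋₊ → |∑ k ∈ Icc 1 e, δ k| ≤ 1 := by
    intro e _
    rcases Nat.eq_zero_or_pos e with rfl | he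
    · simp
    · rw [Finset.sum_eq_single_of_mem 1 (Finset.mem_Icc.2 ⟨le_rfl, he⟩) (fun k _ hk ↦ by
        simp only [hδdef, if_neg hk])]
      simp [hδdef]
  have hA := hR2 bt₁ b₂ Y α B₂ T₁ K₁ i j hY hα hi hj hbcol₂ hbt₁ hY₁
  have hB := hR2 bt₂ δ Y α 1 T₂ K₁ j i hY hα hj hi hδcol hbt₂ hY₁
  rw [← hI] at hA hB
  rw [hsplit, hswap, hδδ]
  calc _ ≤ |∑ k₁ ∈ I, ∑ k₂ ∈ I, bt₁ k₁ * b₂ k₂ * ellp Y k₁ ^ i * ellp Y k₂ ^ j * R (α * k₁ * k₂)| +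
        |c₁ * ∑ k₁ ∈ I, ∑ k₂ ∈ I, bt₂ k₁ * δ k₂ * ellp Y k₁ ^ j * ellp Y k₂ ^ i * R (α * k₁ * k₂)| +
        |c₁ * c₂ * (ellp Y 1 ^ i * ellp Y 1 ^ j * R α)| := abs_add_three _ _ _
    _ ≤ _ := by
        rw [abs_mul, abs_mul, abs_mul, abs_mul, abs_mul, abs_pow, abs_pow, abs_of_nonneg (ellp_nonneg Y 1)]
        have h3 : |c₁| * |c₂| * (ellp Y 1 ^ i * ellp Y 1 ^ j * |R α|) = |c₁| * |c₂| * ellp Y 1 ^ i * ellp Y 1 ^ j * |R α| := by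
          ring
        rw [h3]
        exact add_le_add (add_le_add hA (mul_le_mul_of_nonneg_left hB (abs_nonneg c₁))) le_rfl

end Summit.Parity.GeneralizedHardyLittlewood.Theorems.MomentsBeyondDiagonal.DiagCorner

end
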